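import Summits.QuantumFields.BalabanUV.Beta.GAN24.InsertionChainLaw

/-!
# `BalabanUV.Beta.GAN24.NestedMultiplierWordLaw` — binder row G-an2-4 ∕ (CONV-C), routes C-R6° («VALUES») × R7 («TWO CURRENCIES»), PART 216:
# THE ONE-STEP AVERAGED LAW OF THE FIRST INSERTION WORD `G·(D·N)·G` WITHOUT THE LEFT (H-bd) LETTER — for a BOUNDED multiplier `D` (no smoothness) times a stencil `N`,
# from the RIGHT letter `‖NG‖`, the free letters `e₁, f`, the sandwiched consistency `e₂`, and THREE DERIVATIVE-ITEM LETTERS `e₀^∇ = ‖N′G′(1 − JJᴴ)‖`,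
# `e₁^∇ = ‖N′(G′J − JG)‖`, `f^∇ = ‖NGFᴴ‖`; along a tower: `OneStepAveragedLaw` and `TowerLimitRate` for `k ↦ G_k(D_kN_k)G_k` — the located «words-law with right letters»
# of census V202′ (b′) (the indicator 1-forms) as an abstract theorem (unit b2b-balaban-gan24-p3, gen 63; v1)

NOT IN PRINT; OUR PROOF ([folklore] finite-dimensional operator algebra in the `ℓ²`-operator norm over PART 115 (`InsertionChainLaw`: the sandwich identity, `n = 1`) and the
t4-ne2-p1 lineage's `Spine/CovariantAveragingTower` (`OneStepAveragedLaw`, `TowerLimitRate`, `towerLimitRate_of_oneStepAveragedLaw`) ∕ `Spine/BackgroundResolventTower`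
(`FreeTowerLaws`, `opNorm_normalised_le`) BY NAME; [King1986] Lemma 4.5 p. 665 «replace one by one every factor» is the printed pattern, method reference only; nothing printed
is a hypothesis).
HONEST FRAMING (cell contract, verbatim): «discharging `BetaPertH` makes Bałaban's UV stability UNCONDITIONAL — a real constructive-QFT result; it is NOT the
continuum limit and NOT the Clay problem.»  HONEST DEPENDENCY (verbatim): «continuum YM on T⁴ ⇐ BetaPertH ∧ nine spine estimates (0/9 proved); BetaPertH ⇐
(D1) ∧ (D4) ∧ CAP+tail; G-an2-4 gates asym, D1 and NE2/3/4.»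

WHY (census V202′ (b′) ∕ V204).  The geometric step rate (L-SR) of the insertion word `X_k = avgTow(𝒢_kP_k𝒢_k)` is, by PART 122 ∕ 198, the tower rate of the word in
OPERATOR norm interpolated with (UD).  PART 115's word law (`opNorm_insertion_sandwich_le`, `n = 1`) consumes BOTH (H-bd) letters `‖PG‖` and `‖GP‖, ‖G′P′‖`; for the
INDICATOR 1-forms `P = diag(𝟙_B)·∇` the LEFT letter `‖𝒢·diag(𝟙_B)∇‖` is unbounded (gen 62's face-layer test function), while the right letter `‖diag(𝟙_B)∇𝒢‖ ≤ ‖∇𝒢‖`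
and — for EXACTLY NESTED indicators `𝟙_{B′} = 𝟙_B ∘ par`, which commute with the block projection — the sandwiched consistency `e₂` survive.  This file re-runs the `n = 1`
sandwich identity grouping every occurrence of the left letter as `(G′D′)·(N′·…)` resp. `(GD)·(N·…)`: what is then consumed is `‖G‖, ‖G′‖ ≤ g` (coercivity), `‖D‖, ‖D′‖ ≤ α`
(boundedness ONLY), the right letter `‖NG‖ ≤ κ`, the free letters `e₁ = ‖G′J − JG‖`, `f = ‖FG‖`, the consistency `e₂ = ‖G′((D′N′)J − J(DN))G‖`, and three letters of the
DERIVATIVE ITEM `∇𝒢`: its complement defect `e₀^∇ = ‖N′G′(1 − JJᴴ)‖`, its injected defect `e₁^∇ = ‖N′(G′J − JG)‖`, its pairing defect `f^∇ = ‖NGFᴴ‖` — the located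
interface for the indicator's (L-SR) (to be supplied for `(calDalev, QBlev, JpcT, fdiff)`; NOT in the tree, NOT asserted here).

WHAT THIS FILE PROVES (0 sorry, 0 `def`, nothing cited; complex matrices, `ℓ²`-operator norm; `G, D, N, F : n × n`, `G′, D′, N′ : m × m`, `J : m × n`, `Ã : n × m` ANY matrices):
* §1 **`word_injected_eq`** (EXACT): `G′(D′N′)G′J − J·G(DN)G = G′D′·N′(G′J − JG) + G′((D′N′)J − J(DN))G + (G′J − JG)·D(NG)`; **`word_sandwich_eq`** (EXACT, `ÃJ = 1 + F`):
  `Ã·G′(D′N′)G′·Ãᴴ − G(DN)G = Ã((T′J − JT)Jᴴ + G′D′·N′G′(1 − JJᴴ))Ãᴴ + FG·D(NG)·(ÃJ)ᴴ + GD·(NGFᴴ)`.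
* §2 **`opNorm_word_sandwich_le_right`**: `‖ÃT′Ãᴴ − T‖ ≤ gα·e₁^∇ + e₂ + e₁ακ + gα·e₀^∇ + fακ + gα·f^∇` from `‖G‖, ‖G′‖ ≤ g`, `‖D‖, ‖D′‖ ≤ α`, `‖NG‖ ≤ κ`, `‖Ã‖, ‖J‖ ≤ 1`,
  `ÃJ = 1 + F`, `‖FG‖ ≤ f`, `‖G′J − JG‖ ≤ e₁`, `‖G′((D′N′)J − J(DN))G‖ ≤ e₂`, `‖N′G′(1 − JJᴴ)‖ ≤ e₀^∇`, `‖N′(G′J − JG)‖ ≤ e₁^∇`, `‖NGFᴴ‖ ≤ f^∇` — NO `‖GDN‖`, NO `‖G′D′N′‖`.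
* §3 ALONG A TOWER (`FreeTowerLaws Δ A J F r e₀ e₁ f` supplies `Ã_k = √r·A_k`, `J_k`, `F_k`, `e₁`, `f`; the other letters displayed as level-indexed hypotheses):
  **`oneStepAveragedLaw_nestedWord`** (`OneStepAveragedLaw A r (k ↦ Δ_k⁻¹(D_kN_k)Δ_k⁻¹) (k ↦ gα·e₁^∇_k + e₂_k + e₁_k·ακ + gα·e₀^∇_k + f_k·ακ + gα·f^∇_k)`) and
  **`towerLimitRate_nestedWord`** (geometric letters `≤ C·ρ^k`, `ρ < 1` ⟹ `TowerLimitRate … (gα(C₁^∇ + C₀^∇ + C_f^∇) + C₂ + ακ(C₁ + C_f)) ρ`).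
WHAT IT DOES NOT DO: supply `e₀^∇, e₁^∇, f^∇` for Bałaban's averaging (INTERFACE REQUEST to the NE2 ∕ T4 support owners; for King's averaging the leaves `B5G183RateTorusW` §7∕§9 treat
the six items of [B5] (1.89)); instantiate on the indicator family (needs in addition the exactly nested block indicators `𝟙_B ∘ par = 𝟙_{B′}` for `e₂` via
`FirstOrderBackgroundModel.consistency_decomp` with `D′ − D̄ = 0`); words of higher order.
SUPPLIER work; NEVER «G-an2-4 closed»; NOT (CONV-C), NOT D1, NOT `BetaPertH`, NOT continuum, NOT Clay.  Records: `HOME/b2b-balaban-gan24-p3/gen63/README.md`.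
-/

noncomputable section

open scoped BigOperators ComplexConjugate Matrix Matrix.Norms.L2Operator
open Filter Topology

namespace Summit.QuantumFields.BalabanUV.Beta.GAN24.NestedMultiplierWordLaw

open Summit.QuantumFields.BalabanUV.T4Continuum
open Summit.QuantumFields.BalabanUV.T4Continuum.CovariantAveragingTower (OneStepAveragedLaw TowerLimitRate towerLimitRate_of_oneStepAveragedLaw)
open Summit.QuantumFields.BalabanUV.T4Continuum.BackgroundResolventTower (FreeTowerLaws opNorm_normalised_le)

/-! ## §1 The exact identities for the word `G(DN)G` at two spacings -/

section TwoLevel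

variable {m n : Type*} [Fintype m] [DecidableEq m] [Fintype n] [DecidableEq n]
variable {G D N : Matrix n n ℂ} {G' D' N' : Matrix m m ℂ} {J : Matrix m n ℂ}

omit [DecidableEq m] [DecidableEq n] in
/-- **`word_injected_eq` — THE INJECTED DEFECT OF THE WORD, EVERY LEFT FACTOR GROUPED AS `G′D′·(N′·…)`** (EXACT):
`G′(D′N′)G′J − J·G(DN)G = G′D′·N′(G′J − JG) + G′((D′N′)J − J(DN))G + (G′J − JG)·D(NG)`. [our proof] -/
theorem word_injected_eq :
    G' * (D' * N') * G' * J - J * (G * (D * N) * G)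
      = G' * D' * (N' * (G' * J - J * G)) + G' * ((D' * N') * J - J * (D * N)) * G + (G' * J - J * G) * (D * (N * G)) := by
  simp only [Matrix.mul_sub, Matrix.sub_mul, Matrix.mul_assoc]
  abel

/-- **`word_sandwich_eq` — THE SANDWICH IDENTITY WITH THE PAIRING `ÃJ = 1 + F`** (EXACT): with `T = G(DN)G`, `T′ = G′(D′N′)G′`,
`ÃT′Ãᴴ − T = Ã((T′J − JT)Jᴴ + G′D′·(N′G′(1 − JJᴴ)))Ãᴴ + FG·(D(NG))·(ÃJ)ᴴ + GD·(NGFᴴ)`. [our proof] -/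
theorem word_sandwich_eq {At : Matrix n m ℂ} {F : Matrix n n ℂ} (hAJ : At * J = 1 + F) :
    At * (G' * (D' * N') * G') * Atᴴ - G * (D * N) * G
      = At * ((G' * (D' * N') * G' * J - J * (G * (D * N) * G)) * Jᴴ + G' * D' * (N' * G' * (1 - J * Jᴴ))) * Atᴴ
        + F * G * (D * (N * G)) * (At * J)ᴴ + G * D * (N * G * Fᴴ) := by
  set T : Matrix n n ℂ := G * (D * N) * G with hTdef
  set T' : Matrix m m ℂ := G' * (D' * N') * G' with hT'def
  have e2 : At * (J * T * Jᴴ) * Atᴴ = (At * J) * T * (At * J)ᴴ := by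
    rw [Matrix.conjTranspose_mul]; simp only [Matrix.mul_assoc]
  have e : At * T' * Atᴴ - T = At * (T' - J * T * Jᴴ) * Atᴴ + F * T * (At * J)ᴴ + T * Fᴴ := by
    rw [Matrix.mul_sub, Matrix.sub_mul, e2, hAJ, Matrix.conjTranspose_add, Matrix.conjTranspose_one]
    simp only [Matrix.add_mul, Matrix.mul_add, Matrix.one_mul, Matrix.mul_one]
    abel
  have e3 : T' - J * T * Jᴴ = (T' * J - J * T) * Jᴴ + T' * (1 - J * Jᴴ) := by
    rw [Matrix.sub_mul, Matrix.mul_sub, Matrix.mul_one, Matrix.mul_assoc T' J Jᴴ]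
    abel
  have eT' : T' * (1 - J * Jᴴ) = G' * D' * (N' * G' * (1 - J * Jᴴ)) := by rw [hT'def]; simp only [Matrix.mul_assoc]
  have eFT : F * T * (At * J)ᴴ = F * G * (D * (N * G)) * (At * J)ᴴ := by rw [hTdef]; simp only [Matrix.mul_assoc]
  have eTF : T * Fᴴ = G * D * (N * G * Fᴴ) := by rw [hTdef]; simp only [Matrix.mul_assoc]
  rw [e, e3, eT', eFT, eTF]

end TwoLevel

/-! ## §2 The bound: right letter, free letters, consistency, and the three derivative-item letters — no left (H-bd) letter -/

section Bound

variable {m n : Type*} [Fintype m] [DecidableEq m] [Fintype n] [DecidableEq n]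
variable {G D N : Matrix n n ℂ} {G' D' N' : Matrix m m ℂ} {J : Matrix m n ℂ}

/-- **`opNorm_word_sandwich_le_right` — THE ONE-STEP SANDWICH LAW OF `G(DN)G` FROM RIGHT LETTERS ONLY** [our proof]: `‖G‖, ‖G′‖ ≤ g`, `‖D‖, ‖D′‖ ≤ α`, `‖NG‖ ≤ κ`,
`‖Ã‖, ‖J‖ ≤ 1`, `ÃJ = 1 + F`, `‖FG‖ ≤ f`, `‖G′J − JG‖ ≤ e₁`, `‖G′((D′N′)J − J(DN))G‖ ≤ e₂`, `‖N′G′(1 − JJᴴ)‖ ≤ e₀^∇`, `‖N′(G′J − JG)‖ ≤ e₁^∇`, `‖NGFᴴ‖ ≤ f^∇` ⟹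
`‖Ã·G′(D′N′)G′·Ãᴴ − G(DN)G‖ ≤ gα·e₁^∇ + e₂ + e₁·(ακ) + gα·e₀^∇ + f·(ακ) + gα·f^∇`.  The multiplier `D` enters through its NORM only. -/
theorem opNorm_word_sandwich_le_right {g α κ e₁ e₂ f e₀' e₁' f' : ℝ} (hG : ‖G‖ ≤ g) (hG' : ‖G'‖ ≤ g) (hD : ‖D‖ ≤ α) (hD' : ‖D'‖ ≤ α) (hNG : ‖N * G‖ ≤ κ)
    {At : Matrix n m ℂ} (hAt : ‖At‖ ≤ 1) (hJ : ‖J‖ ≤ 1) {F : Matrix n n ℂ} (hAJ : At * J = 1 + F) (hF : ‖F * G‖ ≤ f) (h₁ : ‖G' * J - J * G‖ ≤ e₁)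
    (h₂ : ‖G' * ((D' * N') * J - J * (D * N)) * G‖ ≤ e₂) (h₀' : ‖N' * G' * (1 - J * Jᴴ)‖ ≤ e₀') (h₁' : ‖N' * (G' * J - J * G)‖ ≤ e₁') (hf' : ‖N * G * Fᴴ‖ ≤ f') :
    ‖At * (G' * (D' * N') * G') * Atᴴ - G * (D * N) * G‖ ≤ g * α * e₁' + e₂ + e₁ * (α * κ) + g * α * e₀' + f * (α * κ) + g * α * f' := by
  have hg : 0 ≤ g := (norm_nonneg _).trans hG
  have hα : 0 ≤ α := (norm_nonneg _).trans hD
  have hκ : 0 ≤ κ := (norm_nonneg _).trans hNG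
  have hf : 0 ≤ f := (norm_nonneg _).trans hF
  have he₁ : 0 ≤ e₁ := (norm_nonneg _).trans h₁
  have hAt' : ‖Atᴴ‖ ≤ 1 := by rw [Matrix.l2_opNorm_conjTranspose]; exact hAt
  have hJ' : ‖Jᴴ‖ ≤ 1 := by rw [Matrix.l2_opNorm_conjTranspose]; exact hJ
  have hAJn : ‖(At * J)ᴴ‖ ≤ 1 := by
    rw [Matrix.l2_opNorm_conjTranspose]
    calc ‖At * J‖ ≤ ‖At‖ * ‖J‖ := Matrix.l2_opNorm_mul _ _
      _ ≤ 1 * 1 := mul_le_mul hAt hJ (norm_nonneg _) zero_le_one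
      _ = 1 := one_mul 1
  have hGD : ‖G * D‖ ≤ g * α := (Matrix.l2_opNorm_mul _ _).trans (mul_le_mul hG hD (norm_nonneg _) hg)
  have hG'D' : ‖G' * D'‖ ≤ g * α := (Matrix.l2_opNorm_mul _ _).trans (mul_le_mul hG' hD' (norm_nonneg _) hg)
  have hDNG : ‖D * (N * G)‖ ≤ α * κ := (Matrix.l2_opNorm_mul _ _).trans (mul_le_mul hD hNG (norm_nonneg _) hα)
  -- the injected defect of the word
  have hinj : ‖G' * (D' * N') * G' * J - J * (G * (D * N) * G)‖ ≤ g * α * e₁' + e₂ + e₁ * (α * κ) := by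
    rw [word_injected_eq]
    refine (norm_add_le _ _).trans (add_le_add ((norm_add_le _ _).trans (add_le_add ?_ h₂)) ?_)
    · exact (Matrix.l2_opNorm_mul _ _).trans (mul_le_mul hG'D' h₁' (norm_nonneg _) (by positivity))
    · exact (Matrix.l2_opNorm_mul _ _).trans (mul_le_mul h₁ hDNG (norm_nonneg _) he₁)
  have hinj0 : 0 ≤ g * α * e₁' + e₂ + e₁ * (α * κ) := (norm_nonneg _).trans hinj
  rw [word_sandwich_eq hAJ]
  refine (norm_add_le _ _).trans (add_le_add ((norm_add_le _ _).trans (add_le_add ?_ ?_)) ?_)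
  · -- `Ã((T′J − JT)Jᴴ + G′D′·N′G′(1 − JJᴴ))Ãᴴ`
    have t1 : ‖(G' * (D' * N') * G' * J - J * (G * (D * N) * G)) * Jᴴ + G' * D' * (N' * G' * (1 - J * Jᴴ))‖ ≤ (g * α * e₁' + e₂ + e₁ * (α * κ)) + g * α * e₀' := by
      refine (norm_add_le _ _).trans (add_le_add ?_ ?_)
      · calc _ ≤ ‖G' * (D' * N') * G' * J - J * (G * (D * N) * G)‖ * ‖Jᴴ‖ := Matrix.l2_opNorm_mul _ _
          _ ≤ (g * α * e₁' + e₂ + e₁ * (α * κ)) * 1 := mul_le_mul hinj hJ' (norm_nonneg _) hinj0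
          _ = _ := mul_one _
      · exact (Matrix.l2_opNorm_mul _ _).trans (mul_le_mul hG'D' h₀' (norm_nonneg _) (by positivity))
    have t0 : 0 ≤ (g * α * e₁' + e₂ + e₁ * (α * κ)) + g * α * e₀' := (norm_nonneg _).trans t1
    calc _ ≤ ‖At * ((G' * (D' * N') * G' * J - J * (G * (D * N) * G)) * Jᴴ + G' * D' * (N' * G' * (1 - J * Jᴴ)))‖ * ‖Atᴴ‖ := Matrix.l2_opNorm_mul _ _
      _ ≤ (‖At‖ * ‖(G' * (D' * N') * G' * J - J * (G * (D * N) * G)) * Jᴴ + G' * D' * (N' * G' * (1 - J * Jᴴ))‖) * 1 :=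
          mul_le_mul (Matrix.l2_opNorm_mul _ _) hAt' (norm_nonneg _) (mul_nonneg (norm_nonneg _) (norm_nonneg _))
      _ ≤ (1 * ((g * α * e₁' + e₂ + e₁ * (α * κ)) + g * α * e₀')) * 1 :=
          mul_le_mul_of_nonneg_right (mul_le_mul hAt t1 (norm_nonneg _) zero_le_one) zero_le_one
      _ = g * α * e₁' + e₂ + e₁ * (α * κ) + g * α * e₀' := by ring
  · -- `FG·D(NG)·(ÃJ)ᴴ`
    calc _ ≤ ‖F * G * (D * (N * G))‖ * ‖(At * J)ᴴ‖ := Matrix.l2_opNorm_mul _ _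
      _ ≤ (‖F * G‖ * ‖D * (N * G)‖) * 1 := mul_le_mul (Matrix.l2_opNorm_mul _ _) hAJn (norm_nonneg _) (mul_nonneg (norm_nonneg _) (norm_nonneg _))
      _ ≤ (f * (α * κ)) * 1 := mul_le_mul_of_nonneg_right (mul_le_mul hF hDNG (norm_nonneg _) hf) zero_le_one
      _ = f * (α * κ) := mul_one _
  · -- `GD·(NGFᴴ)`
    exact (Matrix.l2_opNorm_mul _ _).trans (mul_le_mul hGD hf' (norm_nonneg _) (by positivity))

end Bound

/-! ## §3 Along a tower: the one-step averaged law and the tower limit with rate for `k ↦ Δ_k⁻¹(D_kN_k)Δ_k⁻¹` -/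

section Tower

variable {ι : ℕ → Type*} [∀ k, Fintype (ι k)] [∀ k, DecidableEq (ι k)]
variable {Δ Dm N : (k : ℕ) → Matrix (ι k) (ι k) ℂ} {A : (k : ℕ) → Matrix (ι k) (ι (k + 1)) ℂ}
  {J : (k : ℕ) → Matrix (ι (k + 1)) (ι k) ℂ} {F : (k : ℕ) → Matrix (ι k) (ι k) ℂ} {r g α κ : ℝ} {e₀ e₁ f e₂ e₀' e₁' f' : ℕ → ℝ}

/-- **`oneStepAveragedLaw_nestedWord` — THE ONE-STEP AVERAGED LAW OF THE WORD TOWER `k ↦ Δ_k⁻¹(D_kN_k)Δ_k⁻¹` FROM RIGHT LETTERS** [our proof]: over `FreeTowerLaws Δ A J F r e₀ e₁ f`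
(`Ã_k = √r·A_k`, the injected defect `e₁`, the pairing defect `f`), with `‖Δ_k⁻¹‖ ≤ g`, `‖D_k‖ ≤ α`, `‖N_kΔ_k⁻¹‖ ≤ κ`, the sandwiched consistency
`‖Δ_{k+1}⁻¹((D_{k+1}N_{k+1})J_k − J_k(D_kN_k))Δ_k⁻¹‖ ≤ e₂ k` and the three derivative-item letters `‖N_{k+1}Δ_{k+1}⁻¹(1 − J_kJ_kᴴ)‖ ≤ e₀′ k`, `‖N_{k+1}(Δ_{k+1}⁻¹J_k − J_kΔ_k⁻¹)‖ ≤ e₁′ k`,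
`‖N_kΔ_k⁻¹F_kᴴ‖ ≤ f′ k` (DISPLAYED hypotheses — NOT in the tree for Bałaban's averaging):
`OneStepAveragedLaw A r (k ↦ Δ_k⁻¹(D_kN_k)Δ_k⁻¹) (k ↦ gα·e₁′ k + e₂ k + e₁ k·(ακ) + gα·e₀′ k + f k·(ακ) + gα·f′ k)`. -/
theorem oneStepAveragedLaw_nestedWord (hr : 0 < r) (hfree : FreeTowerLaws Δ A J F r e₀ e₁ f)
    (hG : ∀ k, ‖(Δ k)⁻¹‖ ≤ g) (hD : ∀ k, ‖Dm k‖ ≤ α) (hNG : ∀ k, ‖N k * (Δ k)⁻¹‖ ≤ κ)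
    (h₂ : ∀ k, ‖(Δ (k + 1))⁻¹ * ((Dm (k + 1) * N (k + 1)) * J k - J k * (Dm k * N k)) * (Δ k)⁻¹‖ ≤ e₂ k)
    (h₀' : ∀ k, ‖N (k + 1) * (Δ (k + 1))⁻¹ * (1 - J k * (J k)ᴴ)‖ ≤ e₀' k)
    (h₁' : ∀ k, ‖N (k + 1) * ((Δ (k + 1))⁻¹ * J k - J k * (Δ k)⁻¹)‖ ≤ e₁' k)
    (hf' : ∀ k, ‖N k * (Δ k)⁻¹ * (F k)ᴴ‖ ≤ f' k) :
    OneStepAveragedLaw A r (fun k => (Δ k)⁻¹ * (Dm k * N k) * (Δ k)⁻¹)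
      (fun k => g * α * e₁' k + e₂ k + e₁ k * (α * κ) + g * α * e₀' k + f k * (α * κ) + g * α * f' k) := by
  intro k
  have hs0 : 0 < Real.sqrt r := Real.sqrt_pos.mpr hr
  set At : Matrix (ι k) (ι (k + 1)) ℂ := (((Real.sqrt r : ℝ) : ℂ)) • A k with hAt_def
  have hAt : ‖At‖ ≤ 1 := opNorm_normalised_le hr (hfree.opNorm_A_sq_le k)
  have hAJ : At * J k = 1 + F k := by rw [hAt_def, Matrix.smul_mul]; exact hfree.A_mul_J k
  have key := opNorm_word_sandwich_le_right (G := (Δ k)⁻¹) (G' := (Δ (k + 1))⁻¹) (D := Dm k) (D' := Dm (k + 1)) (N := N k) (N' := N (k + 1)) (J := J k)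
    (hG k) (hG (k + 1)) (hD k) (hD (k + 1)) (hNG k) hAt (hfree.opNorm_J_le k) hAJ (hfree.opNorm_F_mul_inv_le k) (hfree.injected_le k) (h₂ k) (h₀' k) (h₁' k) (hf' k)
  -- `A X′ Aᴴ − r⁻¹X = r⁻¹·(Ã X′ Ãᴴ − X)`
  have hss : star ((((Real.sqrt r : ℝ) : ℂ))) = (((Real.sqrt r : ℝ) : ℂ)) := Complex.conj_ofReal _
  have hsq : ((((Real.sqrt r : ℝ) : ℂ))) * (((Real.sqrt r : ℝ) : ℂ)) = (r : ℂ) := by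
    rw [← Complex.ofReal_mul, Real.mul_self_sqrt hr.le]
  have hrC : (r : ℂ) ≠ 0 := by exact_mod_cast hr.ne'
  have e : A k * ((Δ (k + 1))⁻¹ * (Dm (k + 1) * N (k + 1)) * (Δ (k + 1))⁻¹) * (A k)ᴴ - ((r : ℂ))⁻¹ • ((Δ k)⁻¹ * (Dm k * N k) * (Δ k)⁻¹)
      = ((r : ℂ))⁻¹ • (At * ((Δ (k + 1))⁻¹ * (Dm (k + 1) * N (k + 1)) * (Δ (k + 1))⁻¹) * Atᴴ - (Δ k)⁻¹ * (Dm k * N k) * (Δ k)⁻¹) := by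
    rw [hAt_def, Matrix.conjTranspose_smul, hss, Matrix.smul_mul, Matrix.smul_mul, Matrix.mul_smul, smul_smul, hsq, smul_sub, smul_smul,
      inv_mul_cancel₀ hrC, one_smul]
  rw [e, norm_smul, norm_inv, Complex.norm_real, Real.norm_of_nonneg hr.le]
  exact mul_le_mul_of_nonneg_left key (inv_nonneg.mpr hr.le)

/-- **`towerLimitRate_nestedWord` — THE TOWER LIMIT WITH RATE FOR THE WORD WITH A BOUNDED NESTED MULTIPLIER** [our proof]: if all the letters of
`oneStepAveragedLaw_nestedWord` are geometric, `e₁ k ≤ C₁ρ^k`, `f k ≤ C_fρ^k`, `e₂ k ≤ C₂ρ^k`, `e₀′ k ≤ C₀′ρ^k`, `e₁′ k ≤ C₁′ρ^k`, `f′ k ≤ C_f′ρ^k` with `ρ < 1`, then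
`TowerLimitRate A r (k ↦ Δ_k⁻¹(D_kN_k)Δ_k⁻¹) (gα(C₁′ + C₀′ + C_f′) + C₂ + ακ(C₁ + C_f)) ρ` — the unit-lattice images converge with rate `ρ^k`; with (UD) on both levels this is the
(L-SR) of the insertion word at ratio `√ρ` (PART 198's interpolation), for a background that is merely BOUNDED. -/
theorem towerLimitRate_nestedWord (hr : 0 < r) (hfree : FreeTowerLaws Δ A J F r e₀ e₁ f)
    (hG : ∀ k, ‖(Δ k)⁻¹‖ ≤ g) (hD : ∀ k, ‖Dm k‖ ≤ α) (hNG : ∀ k, ‖N k * (Δ k)⁻¹‖ ≤ κ)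
    (h₂ : ∀ k, ‖(Δ (k + 1))⁻¹ * ((Dm (k + 1) * N (k + 1)) * J k - J k * (Dm k * N k)) * (Δ k)⁻¹‖ ≤ e₂ k)
    (h₀' : ∀ k, ‖N (k + 1) * (Δ (k + 1))⁻¹ * (1 - J k * (J k)ᴴ)‖ ≤ e₀' k)
    (h₁' : ∀ k, ‖N (k + 1) * ((Δ (k + 1))⁻¹ * J k - J k * (Δ k)⁻¹)‖ ≤ e₁' k)
    (hf' : ∀ k, ‖N k * (Δ k)⁻¹ * (F k)ᴴ‖ ≤ f' k)
    {ρ C₁ Cf C₂ C₀' C₁' Cf' : ℝ} (hρ1 : ρ < 1) (hc₁ : ∀ k, e₁ k ≤ C₁ * ρ ^ k) (hcf : ∀ k, f k ≤ Cf * ρ ^ k) (hc₂ : ∀ k, e₂ k ≤ C₂ * ρ ^ k)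
    (hc₀' : ∀ k, e₀' k ≤ C₀' * ρ ^ k) (hc₁' : ∀ k, e₁' k ≤ C₁' * ρ ^ k) (hcf' : ∀ k, f' k ≤ Cf' * ρ ^ k) :
    TowerLimitRate A r (fun k => (Δ k)⁻¹ * (Dm k * N k) * (Δ k)⁻¹) (g * α * (C₁' + C₀' + Cf') + C₂ + α * κ * (C₁ + Cf)) ρ := by
  have hg : 0 ≤ g := (norm_nonneg _).trans (hG 0)
  have hα : 0 ≤ α := (norm_nonneg _).trans (hD 0)
  have hκ : 0 ≤ κ := (norm_nonneg _).trans (hNG 0)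
  have hlaw : OneStepAveragedLaw A r (fun k => (Δ k)⁻¹ * (Dm k * N k) * (Δ k)⁻¹)
      (fun k => (g * α * (C₁' + C₀' + Cf') + C₂ + α * κ * (C₁ + Cf)) * ρ ^ k) := by
    intro k
    refine (oneStepAveragedLaw_nestedWord hr hfree hG hD hNG h₂ h₀' h₁' hf' k).trans (mul_le_mul_of_nonneg_left ?_ (inv_nonneg.mpr hr.le))
    have hgα : 0 ≤ g * α := mul_nonneg hg hα
    have hακ : 0 ≤ α * κ := mul_nonneg hα hκ
    have a1 : g * α * e₁' k ≤ g * α * (C₁' * ρ ^ k) := mul_le_mul_of_nonneg_left (hc₁' k) hgα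
    have a2 : g * α * e₀' k ≤ g * α * (C₀' * ρ ^ k) := mul_le_mul_of_nonneg_left (hc₀' k) hgα
    have a3 : g * α * f' k ≤ g * α * (Cf' * ρ ^ k) := mul_le_mul_of_nonneg_left (hcf' k) hgα
    have a4 : e₁ k * (α * κ) ≤ (C₁ * ρ ^ k) * (α * κ) := mul_le_mul_of_nonneg_right (hc₁ k) hακ
    have a5 : f k * (α * κ) ≤ (Cf * ρ ^ k) * (α * κ) := mul_le_mul_of_nonneg_right (hcf k) hακ
    nlinarith [a1, a2, a3, a4, a5, hc₂ k]
  exact towerLimitRate_of_oneStepAveragedLaw A hr hfree.opNorm_A_sq_le _ hρ1 hlaw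

end Tower

end Summit.QuantumFields.BalabanUV.Beta.GAN24.NestedMultiplierWordLaw

end
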